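import Summits.Ventures.YMGap.FlowData.TubeTransferBilinearReduction
import Literature.MathematicalPhysics.QuantumFieldTheory.FlatLatticeGaugeFields

/-!
# Venture YMGap, track Y3 FLOW-DATA — ZERO MODES of the Gauss-law kinetic operator: `𝒦 g = 0` whenever the gauge
# average of `g` vanishes (theorems only)

HONEST FRAMING: venture file of the cell `pub-ymgap` (QuantumFields programme), track Y3, lineage A (seat flow-eng-1).
Finite Haar integrals over `G^{links}` of one time slice of the tube `(ℤ/L)^k` (compact second-countable `G`, continuous
unitary `ρ`); no number, no row, nothing about `L → ∞`, the continuum or a mass gap.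

WHY.  In the end-to-end operator-level kept-set tail theorem for the typed tube (`KWeightTailTubeMain`) the kept family
must consist of eigenvectors of the Gauss-law kinetic operator `𝒦` (kernel `k(a,b) = ∫ e^{J elecSum(a,E,b)} dE`) AND span
the kept isotypic components.  The engine's spin networks are eigenvectors (`kineticOp_apply_net`); the components are
completed by GAUGE-VARIANT functions, and this file shows that those with vanishing gauge average are ZERO MODES:

* `integral_kineticKernel_mul_eq_integral_gaugeAverage` — for integrable `g` and every `a`,
  `∫ k(a,b) g(b) db = ∫ e^{J elecSum(a,1,b)} (∫ g(b^E) dE) db` (the temporal links as a gauge transformation of the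
  later slice, Fubini, the measure-preserving change of variables `b ↦ b^{E⁻¹}`, inversion invariance of `dE`);
* **`kineticOp_apply_eq_zero_of_gaugeAverage`** — for any bounded `𝒦` acting a.e. by the kinetic kernel
  (`KWeightTailTubeKinetic.exists_kineticOp`) and `g ∈ L²` with `∫ g(b^E) dE = 0` for a.e. `b`: `𝒦 g = 0`
  (`= 0 • g`, the eigen-relation with weight `0` required of the zero modes).

References: M. Lüscher, Commun. Math. Phys. 54 (1977) 283 [cite: Luscher1977]; M. Creutz, *Quarks, gluons and lattices*
(1983) Ch. 9.
-/

noncomputable section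

open scoped BigOperators ENNReal
open MeasureTheory Filter Function
open Literature.MathematicalPhysics.QuantumFieldTheory Literature.Analysis.OperatorTheory

namespace Summit.Ventures.YMGap.FlowData

namespace KWeightTailOperator

section ZeroMode

variable {G : Type*} [Group G] [TopologicalSpace G] [IsTopologicalGroup G] [CompactSpace G]
  [MeasurableSpace G] [BorelSpace G] [SecondCountableTopology G] {n : ℕ} (ρ : G →* Matrix (Fin n) (Fin n) ℂ)
  (J : ℝ) {k L : ℕ} [NeZero L]

omit [TopologicalSpace G] [IsTopologicalGroup G] [CompactSpace G] [MeasurableSpace G] [BorelSpace G]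
  [SecondCountableTopology G] [NeZero L] in
/-- `(b^{E⁻¹})^{E} = b`. [folklore] -/
theorem gaugeTransform_gaugeTransform_inv (E : Site k L → G) (b : GaugeConfig k L G) :
    gaugeTransform E (gaugeTransform (fun x => (E x)⁻¹) b) = b := by
  rw [gaugeTransform_gaugeTransform]
  simp only [mul_inv_cancel]
  exact gaugeTransform_one b

/-- **The Gauss-law kernel against `g` = the un-averaged kernel against the GAUGE AVERAGE of `g`**:
`∫ (∫ e^{J elecSum(a,E,b)} dE) g(b) db = ∫ e^{J elecSum(a,1,b)} (∫ g(b^E) dE) db` for integrable `g` and every `a`.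
[cite: Luscher1977] -/
theorem integral_kineticKernel_mul_eq_integral_gaugeAverage (hρ : Continuous ρ)
    (hρu : ∀ g, ρ g ∈ Matrix.unitaryGroup (Fin n) ℂ) {g : GaugeConfig k L G → ℝ}
    (hg : Integrable g (sliceMeasure G k L)) (a : GaugeConfig k L G) :
    ∫ b, (∫ E, Real.exp (J * elecSum (d := k) (L := L) ρ a E b) ∂(Measure.pi fun _ : Site k L => haarProbability G)) *
        g b ∂(sliceMeasure G k L) =
      ∫ b, Real.exp (J * elecSum (d := k) (L := L) ρ a 1 b) *
        (∫ E, g (gaugeTransform E b) ∂(Measure.pi fun _ : Site k L => haarProbability G)) ∂(sliceMeasure G k L) := by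
  set μ := sliceMeasure G k L with hμ
  set πE := (Measure.pi fun _ : Site k L => haarProbability G) with hπE
  set CE : ℝ := Real.exp (|J| * (n * Fintype.card (Edge k L))) with hCE
  have hexp_le : ∀ a b E, Real.exp (J * elecSum (d := k) (L := L) ρ a E b) ≤ CE := fun a b E =>
    exp_elecSum_le ρ J hρu a b E
  have hexp_nn : ∀ a b E, 0 ≤ Real.exp (J * elecSum (d := k) (L := L) ρ a E b) := fun a b E => (Real.exp_pos _).le
  -- Step 1: pull `g b` inside and swap the `b` and `E` integrals
  have h1 : ∀ b : GaugeConfig k L G, (∫ E, Real.exp (J * elecSum (d := k) (L := L) ρ a E b) ∂πE) * g b =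
      ∫ E, Real.exp (J * elecSum (d := k) (L := L) ρ a E b) * g b ∂πE := fun b => (integral_mul_const (g b) _).symm
  simp_rw [h1]
  have hc : Continuous fun p : GaugeConfig k L G × (Site k L → G) =>
      Real.exp (J * elecSum (d := k) (L := L) ρ a p.2 p.1) :=
    Continuous.comp (g := fun q : (GaugeConfig k L G × (Site k L → G)) × GaugeConfig k L G =>
        Real.exp (J * elecSum (d := k) (L := L) ρ q.1.1 q.1.2 q.2))
      (f := fun p : GaugeConfig k L G × (Site k L → G) => ((a, p.2), p.1))
      (continuous_exp_elecSum_pair ρ J hρ) ((continuous_const.prodMk continuous_snd).prodMk continuous_fst)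
  have hint : Integrable (uncurry fun (b : GaugeConfig k L G) (E : Site k L → G) =>
      Real.exp (J * elecSum (d := k) (L := L) ρ a E b) * g b) (μ.prod πE) := by
    have h0 : Integrable (fun p : GaugeConfig k L G × (Site k L → G) => g p.1 * (1 : ℝ)) (μ.prod πE) :=
      hg.mul_prod (integrable_const 1)
    refine (h0.bdd_mul hc.aestronglyMeasurable (c := CE)
      (Eventually.of_forall fun p => by rw [Real.norm_of_nonneg (hexp_nn _ _ _)]; exact hexp_le _ _ _)).congr
      (Eventually.of_forall fun p => ?_)
    simp only [uncurry, mul_one]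
  rw [integral_integral_swap hint]
  -- Step 2: for each `E`, change variables `b ↦ b^{E⁻¹}` so that the kernel loses its temporal links
  have h2 : ∀ E : Site k L → G,
      ∫ b, Real.exp (J * elecSum (d := k) (L := L) ρ a E b) * g b ∂μ =
        ∫ b, Real.exp (J * elecSum (d := k) (L := L) ρ a 1 b) * g (gaugeTransform (fun x => (E x)⁻¹) b) ∂μ := by
    intro E
    have hmp : MeasurePreserving (gaugeTransform (fun x => (E x)⁻¹) : GaugeConfig k L G → GaugeConfig k L G) μ μ :=
      WilsonGauge.measurePreserving_gaugeTransform _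
    set Φ : GaugeConfig k L G → ℝ := fun b =>
      Real.exp (J * elecSum (d := k) (L := L) ρ a 1 b) * g (gaugeTransform (fun x => (E x)⁻¹) b) with hΦ
    have hΦm : AEStronglyMeasurable Φ μ := by
      refine (Continuous.aestronglyMeasurable ?_).mul ?_
      · exact Continuous.comp (g := fun q : (GaugeConfig k L G × (Site k L → G)) × GaugeConfig k L G =>
            Real.exp (J * elecSum (d := k) (L := L) ρ q.1.1 q.1.2 q.2))
          (f := fun b : GaugeConfig k L G => ((a, (1 : Site k L → G)), b))
          (continuous_exp_elecSum_pair ρ J hρ) (continuous_const.prodMk continuous_id)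
      · exact hg.aestronglyMeasurable.comp_measurePreserving hmp
    -- `∫ Φ = ∫ Φ ∘ γ_E`, and `Φ (γ_E b) = e^{J elecSum(a,E,b)} g(b)`
    have hmpE : MeasurePreserving (gaugeTransform E : GaugeConfig k L G → GaugeConfig k L G) μ μ :=
      WilsonGauge.measurePreserving_gaugeTransform E
    have hΦm' : AEStronglyMeasurable Φ (Measure.map (gaugeTransform E) μ) := by rw [hmpE.map_eq]; exact hΦm
    have h := integral_map hmpE.measurable.aemeasurable hΦm'
    rw [hmpE.map_eq] at h
    rw [h]
    refine integral_congr_ae (Eventually.of_forall fun b => ?_)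
    simp only [hΦ]
    -- the temporal links are a gauge transformation of the later slice: `elecSum(a,E,b) = elecSum(a,1,b^E)`
    -- (this is `KWeightTailTubeEigen.elecSum_eq_elecSum_one_gaugeTransform`; unfolded here to keep the imports minimal)
    have hel : elecSum (d := k) (L := L) ρ a E b = elecSum (d := k) (L := L) ρ a 1 (gaugeTransform E b) := by
      unfold elecSum
      refine Finset.sum_congr rfl fun x _ => Finset.sum_congr rfl fun i _ => ?_
      simp only [gaugeTransform, Site.shift, Pi.one_apply, inv_one, one_mul, mul_one]
    rw [hel, gaugeTransform_inv_gaugeTransform]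
  simp_rw [h2]
  -- Step 3: swap back and identify the gauge average (inversion invariance of `dE`)
  have hc1 : Continuous fun b : GaugeConfig k L G => Real.exp (J * elecSum (d := k) (L := L) ρ a 1 b) :=
    Continuous.comp (g := fun q : (GaugeConfig k L G × (Site k L → G)) × GaugeConfig k L G =>
        Real.exp (J * elecSum (d := k) (L := L) ρ q.1.1 q.1.2 q.2))
      (f := fun b : GaugeConfig k L G => ((a, (1 : Site k L → G)), b))
      (continuous_exp_elecSum_pair ρ J hρ) (continuous_const.prodMk continuous_id)
  -- integrability of `(E, b) ↦ e^{J elecSum(a,1,b)} g(b^{E⁻¹})` on `πE × μ`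
  have hcontΘ : Continuous (uncurry fun (E : Site k L → G) (b : GaugeConfig k L G) =>
      gaugeTransform (fun x => (E x)⁻¹) b) := by
    refine continuous_pi fun e => ?_
    simp only [uncurry, gaugeTransform, inv_inv]
    exact ((((continuous_apply e.1).comp continuous_fst).inv).mul ((continuous_apply e).comp continuous_snd)).mul
      ((continuous_apply (e.1.shift e.2)).comp continuous_fst)
  have hmp2 : MeasurePreserving (fun p : (Site k L → G) × GaugeConfig k L G =>
      (p.1, gaugeTransform (fun x => (p.1 x)⁻¹) p.2)) (πE.prod μ) (πE.prod μ) := by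
    refine MeasurePreserving.skew_product (MeasurePreserving.id πE) hcontΘ.measurable ?_
    exact Eventually.of_forall fun E =>
      (WilsonGauge.measurePreserving_gaugeTransform (fun x => (E x)⁻¹) :
        MeasurePreserving (gaugeTransform (fun x => (E x)⁻¹) : GaugeConfig k L G → GaugeConfig k L G) μ μ).map_eq
  have hint2 : Integrable (uncurry fun (E : Site k L → G) (b : GaugeConfig k L G) =>
      Real.exp (J * elecSum (d := k) (L := L) ρ a 1 b) * g (gaugeTransform (fun x => (E x)⁻¹) b)) (πE.prod μ) := by
    have h0 : Integrable (fun p : (Site k L → G) × GaugeConfig k L G => (1 : ℝ) * g p.2) (πE.prod μ) :=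
      (integrable_const 1).mul_prod hg
    have h0' : Integrable (fun p : (Site k L → G) × GaugeConfig k L G =>
        (1 : ℝ) * g (gaugeTransform (fun x => (p.1 x)⁻¹) p.2)) (πE.prod μ) :=
      (hmp2.integrable_comp h0.aestronglyMeasurable).mpr h0
    refine ((h0'.bdd_mul ((hc1.comp continuous_snd).aestronglyMeasurable) (c := CE)
      (Eventually.of_forall fun p => by
        simp only [Function.comp]
        rw [Real.norm_of_nonneg (hexp_nn _ _ _)]; exact hexp_le _ _ _))).congr
      (Eventually.of_forall fun p => ?_)
    simp only [uncurry, Function.comp, one_mul]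
  rw [integral_integral_swap hint2]
  refine integral_congr_ae (Eventually.of_forall fun b => ?_)
  simp only
  rw [integral_const_mul]
  congr 1
  have hinv := integral_inv_eq_self (fun E : Site k L → G => g (gaugeTransform E b)) πE
  simpa only [Pi.inv_def] using hinv

/-- **ZERO MODES of the Gauss-law kinetic operator.**  For any bounded operator `𝒦` on `L²(slice)` acting a.e. by the
kinetic kernel `k(a,b) = ∫ e^{J elecSum(a,E,b)} dE` (such an operator exists: `KWeightTailTubeKinetic.exists_kineticOp`)
and any `g ∈ L²` whose GAUGE AVERAGE vanishes a.e. (`∫ g(b^E) dE = 0` for a.e. `b`): `𝒦 g = 0` — the eigen-relation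
`𝒦 g = 0 • g` with weight `0` that the kept-set tail theorem asks of the gauge-variant members of a kept isotypic
component. [cite: Luscher1977] -/
theorem kineticOp_apply_eq_zero_of_gaugeAverage (hρ : Continuous ρ) (hρu : ∀ g, ρ g ∈ Matrix.unitaryGroup (Fin n) ℂ)
    {𝒦 : Lp ℝ 2 (sliceMeasure G k L) →L[ℝ] Lp ℝ 2 (sliceMeasure G k L)}
    (h𝒦 : ∀ φ, (𝒦 φ : GaugeConfig k L G → ℝ) =ᵐ[sliceMeasure G k L]
        fun a => ∫ b, (∫ E, Real.exp (J * elecSum (d := k) (L := L) ρ a E b)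
          ∂(Measure.pi fun _ : Site k L => haarProbability G)) * φ b ∂(sliceMeasure G k L))
    (g : Lp ℝ 2 (sliceMeasure G k L))
    (hgavg : ∀ᵐ b ∂(sliceMeasure G k L),
        ∫ E, g (gaugeTransform E b) ∂(Measure.pi fun _ : Site k L => haarProbability G) = 0) :
    𝒦 g = 0 := by
  have hgi : Integrable (g : GaugeConfig k L G → ℝ) (sliceMeasure G k L) := (Lp.memLp g).integrable one_le_two
  refine (Lp.eq_zero_iff_ae_eq_zero).mpr ((h𝒦 g).trans (Eventually.of_forall fun a => ?_))
  simp only [Pi.zero_apply]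
  rw [integral_kineticKernel_mul_eq_integral_gaugeAverage ρ J hρ hρu hgi a]
  rw [integral_congr_ae (g := fun _ => (0 : ℝ)) ?_]
  · exact integral_zero _ _
  · filter_upwards [hgavg] with b hb
    simp only [hb, mul_zero]

/-- The same, phrased as the eigen-relation with weight `0` (the shape `𝒦 (f i) = q i • f i` consumed by
`KWeightTailOperator.norm_le_of_galerkin_bound`). [cite: Luscher1977] -/
theorem kineticOp_apply_eq_zero_smul_of_gaugeAverage (hρ : Continuous ρ)
    (hρu : ∀ g, ρ g ∈ Matrix.unitaryGroup (Fin n) ℂ)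
    {𝒦 : Lp ℝ 2 (sliceMeasure G k L) →L[ℝ] Lp ℝ 2 (sliceMeasure G k L)}
    (h𝒦 : ∀ φ, (𝒦 φ : GaugeConfig k L G → ℝ) =ᵐ[sliceMeasure G k L]
        fun a => ∫ b, (∫ E, Real.exp (J * elecSum (d := k) (L := L) ρ a E b)
          ∂(Measure.pi fun _ : Site k L => haarProbability G)) * φ b ∂(sliceMeasure G k L))
    (g : Lp ℝ 2 (sliceMeasure G k L))
    (hgavg : ∀ᵐ b ∂(sliceMeasure G k L),
        ∫ E, g (gaugeTransform E b) ∂(Measure.pi fun _ : Site k L => haarProbability G) = 0) :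
    𝒦 g = (0 : ℝ) • g := by
  rw [zero_smul]
  exact kineticOp_apply_eq_zero_of_gaugeAverage ρ J hρ hρu h𝒦 g hgavg

end ZeroMode

end KWeightTailOperator

end Summit.Ventures.YMGap.FlowData
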